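import Mathlib
import Summits.ValiantsHypothesis.ValiantsHypothesis.Theorems.DivisionGapZeroOneTransferStubTypedGadgets
import Summits.ValiantsHypothesis.ValiantsHypothesis.Theorems.DivisionGapZeroOneTransferStubForbiddenPeel
import Summits.ValiantsHypothesis.ValiantsHypothesis.Theorems.DivisionGapZeroOneTransferStubDimerTypedDecomposition
import Summits.ValiantsHypothesis.ValiantsHypothesis.Theorems.TriangularDimersDivisionEasy.Negative.UnitH

/-!
# Crux `DivisionGap.ZeroOneTransfer` (stmt-ValiantsHypothesis-5066), line `charged-uncharged`, Part D-II
(lead c12): POWERS OF THE DECISIVE INSTANCE ARE NOT UNCHARGED CERTIFICATES — `L₊(D_n^M) ≥ 2^{Ω(n)}`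
uniformly in `M`

The uncharged child `MonotoneMultiples` of the crux asks, at Valiant's rhombus dimer family
`D_n = triPM n` (crux 4), for SOME nonzero `X ≥ 0` with `L₊(D_n · X)` quasi-polynomial; the line's card
lists `X = D_n` (the double-dimer partition function `D_n² = det(Kasteleyn matrix)`) as the first
"bosonisation" candidate.  This file assembles the registered Part-D stubs `stub_dimerTypedDecomposition`
(p157939), `stub_typedGadgets` (p157140) and `stub_forbiddenPeel` (p157703) into

* `triPM_pow_lower_bound` — `T^L ≤ L₊(D_n^M) · (T-1)^L` for even `n ≥ 64`, `M ≥ 1`, `24 L + 60 ≤ n`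
  (`T = 6^44`): every power of `D_n` needs monotone circuits of size `(T/(T-1))^{(n-60)/24} = 2^{Ω(n)}`,
  UNIFORMLY in `M` — the `D_n`-version of the typed vertex count for `per^M`
  (`DivisionGapPerDivisionHardPerPowers.perPow_complexity_lower`);
* `not_qp_complexity_triPM_pow` — hence no constant `c` bounds `L₊(D_n^{M_n})` by `2^((log₂ n + c)^c)` for
  all `n`, whatever the exponents `M_n ≥ 1`;
* `not_mm_certificate_pow` — in the language of `MonotoneMultiples` at `D_n`: no power `X = D_n^M` is an
  uncharged certificate; `not_qp_complexity_triPM_sq` — in particular the double-dimer polynomial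
  `D_n² = det K_n` is not monotone-quasi-polynomial (the square-root-closure corner `f = h = D_n` of the
  charged child `CofactorCharging` is therefore vacuous at the decisive instance).

Mechanism.  By `stub_dimerTypedDecomposition`, `D_n^M = Σ_{t<s} a_t b_t` with `s ≤ L₊(D_n^M)` and each
`a_t` typed `(ρ, γ)` with balanced row support `Z = {ρ ≠ 0}` (`n² < 3|Z| ≤ 2n²`).  Every dimer cover `f`
has its PURE monomial `M · μ_f` in `supp D_n^M` (`smul_dimerExp_mem_support_pow`), hence in some
`supp (a_t b_t)`; TYPE RIGIDITY (`typed_of_pure_mem_support_mul`): then `f` respects the type,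
`x ∈ Z ↔ f x ∈ W` (`W = {γ ≠ 0}`), because the `a_t`-part of a pure monomial lives on the cells
`(x, f x)` where both margins are read off.  By `stub_typedGadgets` + `stub_forbiddenPeel` the covers
respecting a balanced type are at most a `((T-1)/T)^L` fraction of all covers; summing over `t` gives
`#covers ≤ s · ((T-1)/T)^L · #covers`.
[cite: Valiant1980, §3 Thm 1] [cite: JerrumSnir1982, §3.1 Lemma 3.1 and §4.3]
-/

noncomputable section

-- `Summit.ValiantsHypothesis.ValiantsHypothesis.…` is the tree's mandated single-conjunct layout
-- (Sub = Summit), so the duplicated namespace component is intended.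
set_option linter.dupNamespace false

namespace Summit.ValiantsHypothesis.ValiantsHypothesis.Theorems.DivisionGapZeroOneTransfer

open MvPolynomial
open Literature.Computability.AlgebraicComplexity
open Summit.ValiantsHypothesis.ValiantsHypothesis.Theorems.TriangularDimersDivisionEasy.Negative
open scoped NNReal BigOperators

namespace TriPMPow

variable {n : ℕ}

/-! ### Margins and pure monomials of `D_n^M` -/

/-- Row sums of a dimer monomial are `1`. [folklore] -/
theorem rowSum_dimerExp (f : Fin n × Fin n → Fin n × Fin n) (v : Fin n × Fin n) :
    ∑ w, dimerExp f (v, w) = 1 := by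
  classical
  simp only [dimerExp_apply]
  rw [Finset.sum_ite_eq]
  simp

/-- Column sums of the monomial of a dimer cover are `1` (`f v = w ↔ v = f w`). [folklore] -/
theorem colSum_dimerExp {f : Fin n × Fin n → Fin n × Fin n} (hf : IsDimer f) (w : Fin n × Fin n) :
    ∑ v, dimerExp f (v, w) = 1 := by
  classical
  simp only [dimerExp_apply]
  have : ∀ v, (f v = w) ↔ (v = f w) := by
    intro v
    constructor
    · intro h; rw [← h, (hf v).1]
    · intro h; rw [h, (hf w).1]
  simp_rw [this]
  rw [Finset.sum_ite_eq']
  simp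

/-- Every monomial of `D_n^M` has all first-vertex sums and all second-vertex sums equal to `M`.
[folklore] -/
theorem margins_triPM_pow (M : ℕ) :
    ∀ α ∈ (triPM n ^ M).support, (∀ v, ∑ w, α (v, w) = M) ∧ (∀ w, ∑ v, α (v, w) = M) := by
  classical
  induction M with
  | zero =>
    intro α hα
    rw [pow_zero, support_one, Finset.mem_singleton] at hα
    subst hα
    simp
  | succ M ih =>
    intro α hα
    rw [pow_succ] at hα
    obtain ⟨β, hβ, δ, hδ, rfl⟩ := Finset.mem_add.mp (support_mul _ _ hα)
    obtain ⟨f, hf, rfl⟩ := (mem_support_triPM δ).1 hδ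
    have hfd : IsDimer f := (Finset.mem_filter.1 hf).2
    obtain ⟨hr, hc⟩ := ih β hβ
    refine ⟨fun v => ?_, fun w => ?_⟩
    · simp only [Finsupp.coe_add, Pi.add_apply, Finset.sum_add_distrib, hr v, rowSum_dimerExp f v]
    · simp only [Finsupp.coe_add, Pi.add_apply, Finset.sum_add_distrib, hc w, colSum_dimerExp hfd w]

/-- The pure monomials `M • μ_f` occur in `D_n^M` (term `f₁ = ⋯ = f_M = f`; nothing cancels over `ℝ≥0`).
[folklore] -/
theorem smul_dimerExp_mem_support_pow (M : ℕ) {f : Fin n × Fin n → Fin n × Fin n} (hf : f ∈ dimers n) :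
    M • dimerExp f ∈ (triPM n ^ M).support := by
  classical
  induction M with
  | zero =>
    rw [pow_zero, support_one, zero_smul]
    exact Finset.mem_singleton_self 0
  | succ M ih =>
    rw [pow_succ, succ_nsmul]
    exact Literature.Computability.AlgebraicComplexity.add_mem_support_mul ih
      ((mem_support_triPM _).2 ⟨f, hf, rfl⟩)

/-! ### Type rigidity of pure monomials -/

/-- **Type rigidity.**  If every monomial of `p` has first-vertex sums `ρ` and second-vertex sums `γ`,
and the pure monomial `M • μ_f` of a dimer cover `f` lies in `supp (p * q)`, then `γ (f x) = ρ x` for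
all `x`: the `p`-part of `M • μ_f` lives on the cells `(x, f x)`, where both margins are read off.
[cite: JerrumSnir1982, §3.1 Lemma 3.1] -/
theorem typed_of_pure_mem_support_mul {p q : MvPolynomial ((Fin n × Fin n) × (Fin n × Fin n)) ℝ≥0}
    {ρ γ : Fin n × Fin n → ℕ} (M : ℕ)
    (hp : ∀ α ∈ p.support, (∀ v, ∑ w, α (v, w) = ρ v) ∧ (∀ w, ∑ v, α (v, w) = γ w))
    {f : Fin n × Fin n → Fin n × Fin n} (hf : IsDimer f)
    (hmem : M • dimerExp f ∈ (p * q).support) : ∀ x, γ (f x) = ρ x := by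
  classical
  obtain ⟨α, hα, β, -, hαβ⟩ := Finset.mem_add.mp (support_mul p q hmem)
  have hcell : ∀ v w, α (v, w) ≠ 0 → f v = w := by
    intro v w hvw
    have h := DFunLike.congr_fun hαβ (v, w)
    simp only [Finsupp.coe_add, Pi.add_apply, Finsupp.coe_smul, Pi.smul_apply, smul_eq_mul,
      dimerExp_apply] at h
    by_contra hne
    rw [if_neg hne, mul_zero] at h
    omega
  obtain ⟨hr, hc⟩ := hp α hα
  intro x
  have e1 : ∑ w, α (x, w) = α (x, f x) := by
    refine Finset.sum_eq_single (f x) (fun w _ hw => ?_) (by simp)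
    by_contra h
    exact hw (hcell _ _ h).symm
  have e2 : ∑ v, α (v, f x) = α (x, f x) := by
    refine Finset.sum_eq_single x (fun v _ hv => ?_) (by simp)
    by_contra h
    have h1 := hcell v (f x) h
    exact hv (by rw [← (hf v).1, h1, (hf x).1])
  rw [← hr x, ← hc (f x), e1, e2]

end TriPMPow

open TriPMPow

/-- **POWERS OF `D_n` ARE EXPONENTIALLY HARD FOR MONOTONE CIRCUITS, UNIFORMLY IN THE EXPONENT (Part D-II).**
For even `n ≥ 64`, `M ≥ 1` and `24 L + 60 ≤ n`: `T^L ≤ L₊(D_n^M) · (T-1)^L` (`T = 6^44`), i.e.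
`L₊(D_n^M) ≥ (T/(T-1))^L`.  Typed row-support-balanced decomposition + type rigidity of pure monomials +
typed gadget supply + forbidden-edge peeling. [cite: Valiant1980, §3 Thm 1] -/
theorem triPM_pow_lower_bound :
    ∀ (n M : ℕ), Even n → 64 ≤ n → 1 ≤ M → ∀ (L : ℕ), 24 * L + 60 ≤ n →
      Tfib ^ L ≤ complexity (triPM n ^ M) * (Tfib - 1) ^ L := by
  classical
  intro n M he h64 hM L hL
  have hn : 0 < n := by omega
  -- typed balanced decomposition of `D_n^M`
  obtain ⟨s, hs, a, b, hsum, htyp⟩ := stub_dimerTypedDecomposition n (by omega) (triPM n ^ M)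
    (fun _ => M) (fun _ => M) (margins_triPM_pow M) (fun _ => by omega)
  -- for each term, the typed covers are few
  have hterm : ∀ t : Fin s,
      Tfib ^ L * ((dimers n).filter fun f => M • dimerExp f ∈ (a t * b t).support).card ≤
        (Tfib - 1) ^ L * (dimers n).card := by
    intro t
    obtain ⟨ρ, γ, hty, hb1, hb2⟩ := htyp t
    set Z : Finset (Fin n × Fin n) := Finset.univ.filter fun i => ρ i ≠ 0 with hZ
    set W : Finset (Fin n × Fin n) := Finset.univ.filter fun i => γ i ≠ 0 with hW
    -- served covers respect the type
    have hsub : ((dimers n).filter fun f => M • dimerExp f ∈ (a t * b t).support) ⊆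
        (dimers n).filter fun f => ∀ x : Fin n × Fin n, (x ∈ Z ↔ f x ∈ W) := by
      intro f hf
      rw [Finset.mem_filter] at hf ⊢
      refine ⟨hf.1, fun x => ?_⟩
      have hfd : IsDimer f := (Finset.mem_filter.1 hf.1).2
      have key := typed_of_pure_mem_support_mul M hty hfd hf.2 x
      simp only [hZ, hW, Finset.mem_filter, Finset.mem_univ, true_and]
      rw [key]
    -- gadgets and peeling
    obtain ⟨G, hGlen, hGV, hGfar, hGforb⟩ := stub_typedGadgets n hn Z W h64 hb1 hb2
    have hLle : L ≤ G.length := by omega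
    set G' := G.take L with hG'
    have hG'len : G'.length = L := by rw [hG', List.length_take]; exact min_eq_left hLle
    have hsubl : G'.Sublist G := List.take_sublist _ _
    have hpeel := stub_forbiddenPeel n hn Z W G' (fun g hg => hGV g (hsubl.subset hg))
      ((hGfar.sublist (hsubl.map Prod.fst))) (fun g hg => hGforb g (hsubl.subset hg))
    rw [hG'len] at hpeel
    exact (Nat.mul_le_mul_left _ (Finset.card_le_card hsub)).trans hpeel
  -- every cover is served by some term
  have hcov : dimers n ⊆ Finset.univ.biUnion fun t : Fin s =>
      (dimers n).filter fun f => M • dimerExp f ∈ (a t * b t).support := by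
    intro f hf
    have hmem : M • dimerExp f ∈ (triPM n ^ M).support := smul_dimerExp_mem_support_pow M hf
    rw [hsum] at hmem
    obtain ⟨t, -, ht⟩ := Finset.mem_biUnion.1 (support_sum hmem)
    exact Finset.mem_biUnion.2 ⟨t, Finset.mem_univ _, Finset.mem_filter.2 ⟨hf, ht⟩⟩
  have hcard : (dimers n).card ≤ ∑ t : Fin s,
      ((dimers n).filter fun f => M • dimerExp f ∈ (a t * b t).support).card :=
    (Finset.card_le_card hcov).trans Finset.card_biUnion_le
  -- sum up
  have hpos : 0 < (dimers n).card := Finset.card_pos.2 (dimers_nonempty he)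
  have key : Tfib ^ L * (dimers n).card ≤ s * ((Tfib - 1) ^ L * (dimers n).card) := by
    calc Tfib ^ L * (dimers n).card
        ≤ Tfib ^ L * ∑ t : Fin s, ((dimers n).filter fun f => M • dimerExp f ∈ (a t * b t).support).card :=
          Nat.mul_le_mul_left _ hcard
      _ = ∑ t : Fin s, Tfib ^ L * ((dimers n).filter fun f => M • dimerExp f ∈ (a t * b t).support).card := by
          rw [Finset.mul_sum]
      _ ≤ ∑ _t : Fin s, (Tfib - 1) ^ L * (dimers n).card := Finset.sum_le_sum fun t _ => hterm t
      _ = s * ((Tfib - 1) ^ L * (dimers n).card) := by simp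
  have key2 : Tfib ^ L ≤ s * (Tfib - 1) ^ L := by
    have : Tfib ^ L * (dimers n).card ≤ (s * (Tfib - 1) ^ L) * (dimers n).card := by
      rw [mul_assoc]; exact key
    exact Nat.le_of_mul_le_mul_right this hpos
  exact key2.trans (Nat.mul_le_mul_right _ hs)

/-- **No quasi-polynomial bound on the monotone complexity of powers of `D_n`.**  No constant `c` gives
`L₊(D_n^{M_n}) ≤ 2^((log₂ n + c)^c)` for all `n`, whatever the exponents `M_n ≥ 1`. [cite: Valiant1980, §3 Thm 1] -/
theorem not_qp_complexity_triPM_pow :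
    ¬ ∃ c : ℕ, ∀ n : ℕ, ∃ M : ℕ, 1 ≤ M ∧ complexity (triPM n ^ M) ≤ bound c n := by
  rintro ⟨c, H⟩
  obtain ⟨m, hm6, hviol⟩ := exists_m_violating c
  obtain ⟨M, hM, hle⟩ := H (2 ^ m)
  have he : Even (2 ^ m) := Nat.even_pow.2 ⟨even_two, by omega⟩
  have h64 : 64 ≤ 2 ^ m := by
    calc 64 = 2 ^ 6 := by norm_num
      _ ≤ 2 ^ m := Nat.pow_le_pow_right (by norm_num) hm6
  have hlog : Nat.log 2 (2 ^ m) = m := Nat.log_pow (by norm_num) _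
  have hF : complexity (triPM (2 ^ m) ^ M) ≤ 2 ^ ((m + c) ^ c) := by
    unfold bound at hle; rw [hlog] at hle; exact hle
  have hlb : ∀ L, 24 * L + 60 ≤ 2 ^ m →
      Tfib ^ L ≤ 4 * complexity (triPM (2 ^ m) ^ M) * (2 ^ m * 2 ^ m + 1) ^ 2 * (Tfib - 1) ^ L := by
    intro L hL'
    have h1 := triPM_pow_lower_bound (2 ^ m) M he h64 hM L hL'
    refine h1.trans (Nat.mul_le_mul_right _ ?_)
    have h2 : 1 ≤ (2 ^ m * 2 ^ m + 1) ^ 2 := Nat.one_le_pow _ _ (by omega)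
    calc complexity (triPM (2 ^ m) ^ M) = 1 * complexity (triPM (2 ^ m) ^ M) * 1 := by ring
      _ ≤ 4 * complexity (triPM (2 ^ m) ^ M) * (2 ^ m * 2 ^ m + 1) ^ 2 :=
          Nat.mul_le_mul (Nat.mul_le_mul_right _ (by norm_num)) h2
  have hkey := key_ineq_of_bound hm6 hlb hF
  exact absurd (hkey.trans_lt hviol) (lt_irrefl _)

/-- **No power of `D_n` is an uncharged certificate for `D_n`** (`MonotoneMultiples` at the decisive
instance restricted to `X = D_n^M`): no constant `c` gives, for every `n`, an exponent `M` with
`L₊(D_n · D_n^M) ≤ 2^((log₂ n + c)^c)`. [cite: Valiant1980, §3 Thm 1] -/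
theorem not_mm_certificate_pow :
    ¬ ∃ c : ℕ, ∀ n : ℕ, ∃ M : ℕ, complexity (triPM n * triPM n ^ M) ≤ bound c n := by
  rintro ⟨c, H⟩
  refine not_qp_complexity_triPM_pow ⟨c, fun n => ?_⟩
  obtain ⟨M, hM⟩ := H n
  exact ⟨M + 1, by omega, by rw [pow_succ']; exact hM⟩

/-- **The double-dimer polynomial `D_n² = det(Kasteleyn)` is not monotone-quasi-polynomial**: the first
bosonisation candidate of the line's card is exponentially hard for monotone circuits, so at the decisive
instance the square-root-closure corner `f = h = D_n` of `CofactorCharging` is vacuous.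
[cite: Valiant1980, §3 Thm 1] -/
theorem not_qp_complexity_triPM_sq :
    ¬ ∃ c : ℕ, ∀ n : ℕ, complexity (triPM n * triPM n) ≤ bound c n := by
  rintro ⟨c, H⟩
  exact not_mm_certificate_pow ⟨c, fun n => ⟨1, by rw [pow_one]; exact H n⟩⟩

end Summit.ValiantsHypothesis.ValiantsHypothesis.Theorems.DivisionGapZeroOneTransfer

end
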